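import Summits.AnomalousDissipation.AnomalousDissipation.Theorems.ImpulseGridGridSignsLawFirstMomentForm
import Summits.AnomalousDissipation.AnomalousDissipation.Theorems.ImpulseGridGridSignsLawStubAcdcGridAdmissible

/-!
# Route ImpulseGrid (AnomalousDissipation) — `AcdcFirstMomentLaw → GridSignsLaw`

Support file for the crux `GridSignsLaw` (item stmt-AnomalousDissipation-14349), line `Sketch`
(lead continuation c2). It LANDS the composition of the line's skeleton (`Cruxes/GridSignsLaw/
Lines/Sketch.lean`, reshape 3) as a tree theorem: the route crux `AcdcFirstMomentLaw`
(stmt-AnomalousDissipation-18236) — which is, verbatim, the skeleton's single open physics stub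
`stub_firstMomentLawACDC` — implies `GridSignsLaw`.

`AcdcFirstMomentLaw` says: for some mesh `m ≥ 1`, amplitude `A > 0`, AC depth `θ > 0` and drift
`c > 0`, with the explicit AC/DC grid `Φ = 1 + 2θ cos 2πx₀`,
`G = A [sin 2πm(x₁+x₂) (e₁−e₂) + sin 2πm(x₁−x₂) (e₁+e₂)]`, EVERY vanishing-viscosity global
Leray–Hopf family forced by `Φ • G` with drift data `∫u₀ⱼ = c e₀`, per-`j` sup-energy bounds and
`meanEnergy ≤ E` has, eventually in `j` and in one generalized limit `Λ`, non-negative DC work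
`0 ≤ Λ⟨(G, u_j)⟩` and an AC-work floor `κ ≤ Λ⟨((Φ − 1) • G, u_j)⟩`.

Proof of the bridge (`gridSignsLaw_of_acdcFirstMomentLaw`): take the parameters from the law; the
explicit fields together with the sawtooth `Ψ = (θ/π) sin 2πx₀` satisfy the fifteen design clauses
of `GridSignsLaw` (`stub_acdcGridAdmissible`, file `ImpulseGridGridSignsLawStubAcdcGridAdmissible`);
this yields the abstract first-moment law of the crux, which is equivalent to the crux
(`gridSignsLaw_of_firstMomentLaw`, file `ImpulseGridGridSignsLawFirstMomentForm`: `η := cκ/2` via the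
grid injection identity at the weight `Ψ` and the ν-uniform Laplacian pairing bound).

Status consequence: `GridSignsLaw` (stmt-14349) is closed MODULO `AcdcFirstMomentLaw` (stmt-18236)
inside the tree; no further composition work is needed on this crux once stmt-18236 is settled.
No new definitions.

References: C. R. Doering, C. Foias, J. Fluid Mech. 467 (2002) §2 (generalized long-time limits,
mean balances of body-forced Navier–Stokes); C. Foias, O. Manley, R. Rosa, R. Temam,
*Navier–Stokes Equations and Turbulence* (2001), Ch. IV §3.1.
-/

noncomputable section

-- `Summit.<Summit>.<Problem>` is the tree's mandated summit-side namespace (CONVENTIONS §2); for this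
-- single-conjunct summit the two coincide, so the duplicate is deliberate.
set_option linter.dupNamespace false

open MeasureTheory Set Filter Topology
open scoped InnerProductSpace RealInnerProductSpace

namespace Summit.AnomalousDissipation.AnomalousDissipation.Theorems

open Literature.Analysis.FluidPDE Literature.Analysis.FluidPDE.Torus
open Literature.Analysis.FunctionSpaces Literature.Analysis.FunctionSpaces.Torus
open Summit.AnomalousDissipation.AnomalousDissipation.Theses.ImpulseGrid

/-- **The first-moment sign law of the explicit AC/DC grid implies the grid sign law**
(`AcdcFirstMomentLaw → GridSignsLaw`; route cruxes stmt-AnomalousDissipation-18236 → 14349).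
Parameters `(m, A, θ, c)` from the law; the explicit design `Φ = 1 + 2θ cos 2πx₀`,
`Ψ = (θ/π) sin 2πx₀`, `G = A[sin 2πm(x₁+x₂)(e₁−e₂) + sin 2πm(x₁−x₂)(e₁+e₂)]` satisfies the fifteen
design clauses (`stub_acdcGridAdmissible`); the law at these fields is the abstract first-moment law,
which gives the crux by `gridSignsLaw_of_firstMomentLaw` (`η := cκ/2`). [folklore] -/
theorem gridSignsLaw_of_acdcFirstMomentLaw : AcdcFirstMomentLaw → GridSignsLaw := by
  rintro ⟨m, A, θ, c, hm, hA, hθ, hc, hlaw⟩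
  -- the explicit design
  set Φ : UnitAddTorus (Fin 3) → ℝ :=
    fun x => 1 + 2 * θ * (UnitAddTorus.mFourier (Pi.single (0 : Fin 3) (1 : ℤ)) x).re with hΦdef
  set Ψ : UnitAddTorus (Fin 3) → ℝ :=
    fun x => θ / Real.pi * (UnitAddTorus.mFourier (Pi.single (0 : Fin 3) (1 : ℤ)) x).im with hΨdef
  set G : UnitAddTorus (Fin 3) → EuclideanSpace ℝ (Fin 3) := fun x =>
    A • (stokesMode ![(0 : ℤ), (m : ℤ), (m : ℤ)]
        (EuclideanSpace.single (1 : Fin 3) (1 : ℝ) - EuclideanSpace.single (2 : Fin 3) (1 : ℝ)) false x +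
      stokesMode ![(0 : ℤ), (m : ℤ), -(m : ℤ)]
        (EuclideanSpace.single (1 : Fin 3) (1 : ℝ) + EuclideanSpace.single (2 : Fin 3) (1 : ℝ)) false x)
    with hGdef
  -- the fifteen design clauses of the explicit grid
  have hadm := stub_acdcGridAdmissible m A θ c Φ Ψ G hΦdef hΨdef hGdef hm hA hθ hc
  -- the abstract first-moment law at this design, then the equivalence with the crux
  exact gridSignsLaw_of_firstMomentLaw ⟨Φ, Ψ, G, c, hadm, hlaw Φ G hΦdef hGdef⟩

end Summit.AnomalousDissipation.AnomalousDissipation.Theorems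

end
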